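import Mathlib
import Literature.NumberTheory.Transcendental.SemialgebraicLineDeriv
import Literature.NumberTheory.Transcendental.EllIterRep
import HarnessLib

/-!
# Stub `stub_cornerChartUpper`, auxiliary file — crux `TorsionLogs.NeronTorsionSector`
(stmt-KontsevichZagierPeriods-14500), line `registered`, block W2

Pure algebra and `ℚ`-semialgebraic bookkeeping for the compactifying chart `s = x^{-1/2}` at the
point at infinity of the real Weierstrass cubic `y² = f(x) = 4x³ − g₂x − g₃`, UPPER branch
`y = +√f`, translated by `P₁ = (x₁, y₁)` (`y₁ < 0`, `s₁ = x₁^{-1/2}`):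

* `R = √(4 − g₂s⁴ − g₃s⁶) = s³√f(s⁻²)`, `M̂ = s⁴M(s⁻²)`, `Du = R + y₁s³`, and the junk-free numerator
  `Ñ⁺` with `M̂² − 4Du² = s²Ñ⁺` (`cornerUp_key_poly`), whence `τ̂⁺ = Ñ⁺/(4Du²) − x₁` is the
  x-chart translation `τ⁺(s⁻²)` (`cornerUp_tau_chart`) and the third-kind potential matches
  (`cornerUp_Q_chart`, from `M̂ − R·Du = s²A₁⁺`);
* the values at `s₁` (`R(s₁) = −y₁s₁³`, `Ñ⁺(s₁) = s₁⁶f′(x₁)²`, `K̂⁺(s₁)`), using `s₁²x₁ = 1`;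
* the REGULARISATION AT `−P₁`: with `X = E/(4D²)`, `Φ = E³/16 − g₂ED⁴/4 − g₃D⁶` (`= D⁶f(X)`),
  the numerator of the lower translation `τ(X)` is divisible by `D²`:
  `(E² + 4x₁ED² + 4cD⁴)² − 16E(√Φ − y₁D³)² = D²·P` (`cornerUp_big`), so
  `τ(X) = P/(64(√Φ − y₁D³)²) − x₁` (`cornerUp_T_eq`), a formula regular through `D = 0`;
* `ℚ`-semialgebraicity of all the chart functions on any `ℚ`-semialgebraic `S ⊆ ℝ¹`
  (`cornerUp_semialg`: closure of semialgebraic functions under `+, −, ×, ⁻¹` (junk-tolerant), `√`,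
  Bochnak–Coste–Roy Prop. 2.2.6, all in the tree).

All identities are closed by `linear_combination` / `field_simp` / `ring`.

References: J. H. Silverman, *The Arithmetic of Elliptic Curves* (2nd ed., 2009), III.2.3;
M. Kontsevich, D. Zagier, *Periods* (2001), §1.2; J. Bochnak, M. Coste, M.-F. Roy,
*Real Algebraic Geometry* (1998), Prop. 2.2.6.
-/

noncomputable section

-- `Summit.KontsevichZagierPeriods.KontsevichZagierPeriods.…` is the tree's mandated layout (single-conjunct summit).
set_option linter.dupNamespace false

open Set MvPolynomial
open Literature.NumberTheory.Transcendental Literature.ModelTheory.ExponentialFields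

namespace Summit.KontsevichZagierPeriods.KontsevichZagierPeriods.Cruxes.NeronTorsionSector.Translation

/-! ### The chart `x = s⁻²`: algebra -/

/-- **`√f(s⁻²) = R(s)/s³`** for `s > 0` and non-negative radicand `4 − g₂s⁴ − g₃s⁶ = s⁶f(s⁻²)`.
[cite: SilvermanAEC2009, III.2.3] -/
theorem cornerUp_sqrt_chart {g₂ g₃ s : ℝ} (hs : 0 < s) (hrad : 0 ≤ 4 - g₂ * s ^ 4 - g₃ * s ^ 6) :
    Real.sqrt (4 * (s ^ 2)⁻¹ ^ 3 - g₂ * (s ^ 2)⁻¹ - g₃)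
      = Real.sqrt (4 - g₂ * s ^ 4 - g₃ * s ^ 6) / s ^ 3 := by
  have h : 4 * (s ^ 2)⁻¹ ^ 3 - g₂ * (s ^ 2)⁻¹ - g₃ = (4 - g₂ * s ^ 4 - g₃ * s ^ 6) / (s ^ 3) ^ 2 := by
    field_simp
  rw [h, Real.sqrt_div hrad, Real.sqrt_sq (by positivity)]

/-- **The junk-free numerator of the upper translation**: `M̂² − 4Du² = s²·Ñ⁺` modulo `R² = 4 − g₂s⁴ − g₃s⁶`
and `y₁² = f(x₁)` (`M̂ = 4 + 4x₁s² + (4x₁² − g₂)s⁴`, `Du = R + y₁s³`). [cite: SilvermanAEC2009, III.2.3] -/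
theorem cornerUp_key_poly {g₂ g₃ x₁ y₁ s R : ℝ} (hR : R ^ 2 = 4 - g₂ * s ^ 4 - g₃ * s ^ 6)
    (hy : y₁ ^ 2 = 4 * x₁ ^ 3 - g₂ * x₁ - g₃) :
    (4 + 4 * x₁ * s ^ 2 + (4 * x₁ ^ 2 - g₂) * s ^ 4) ^ 2 - 4 * (R + y₁ * s ^ 3) ^ 2
      = s ^ 2 * (32 * x₁ + 4 * (12 * x₁ ^ 2 - g₂) * s ^ 2 - 8 * y₁ * s * R
        + (16 * x₁ ^ 3 - 4 * g₂ * x₁ + 8 * g₃) * s ^ 4 + (4 * x₁ ^ 2 - g₂) ^ 2 * s ^ 6) := by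
  linear_combination (-4) * hR - 4 * s ^ 6 * hy

/-- **`M̂ − R·Du = s²·A₁⁺`** modulo `R² = 4 − g₂s⁴ − g₃s⁶` (`A₁⁺ = 4x₁ − y₁sR + 4x₁²s² + g₃s⁴`): the
regular part of the third-kind potential in the chart. [cite: SilvermanAEC2009, III.2.3] -/
theorem cornerUp_A1_poly {g₂ g₃ x₁ y₁ s R : ℝ} (hR : R ^ 2 = 4 - g₂ * s ^ 4 - g₃ * s ^ 6) :
    (4 + 4 * x₁ * s ^ 2 + (4 * x₁ ^ 2 - g₂) * s ^ 4) - R * (R + y₁ * s ^ 3)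
      = s ^ 2 * (4 * x₁ - y₁ * s * R + 4 * x₁ ^ 2 * s ^ 2 + g₃ * s ^ 4) := by
  linear_combination (-1) * hR

/-- **`τ̂⁺(s) = τ⁺(s⁻²)`**: the regularised chart formula `Ñ⁺/(4Du²) − x₁` is the x-chart translation
`(M(x)/(√f(x) + y₁))²/4 − x − x₁` at `x = s⁻²` (with `√f(s⁻²) = R/s³` already substituted), for `s ≠ 0`,
`Du ≠ 0`. [cite: SilvermanAEC2009, III.2.3] -/
theorem cornerUp_tau_chart {g₂ g₃ x₁ y₁ s R : ℝ} (hs : s ≠ 0) (hD : R + y₁ * s ^ 3 ≠ 0)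
    (hR : R ^ 2 = 4 - g₂ * s ^ 4 - g₃ * s ^ 6) (hy : y₁ ^ 2 = 4 * x₁ ^ 3 - g₂ * x₁ - g₃) :
    (32 * x₁ + 4 * (12 * x₁ ^ 2 - g₂) * s ^ 2 - 8 * y₁ * s * R
        + (16 * x₁ ^ 3 - 4 * g₂ * x₁ + 8 * g₃) * s ^ 4 + (4 * x₁ ^ 2 - g₂) ^ 2 * s ^ 6)
        / (4 * (R + y₁ * s ^ 3) ^ 2) - x₁
      = ((4 * (s ^ 2)⁻¹ ^ 2 + 4 * (s ^ 2)⁻¹ * x₁ + 4 * x₁ ^ 2 - g₂) / (R / s ^ 3 + y₁)) ^ 2 / 4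
        - (s ^ 2)⁻¹ - x₁ := by
  have key := cornerUp_key_poly hR hy
  set D := R + y₁ * s ^ 3 with hDdef
  set Mh := 4 + 4 * x₁ * s ^ 2 + (4 * x₁ ^ 2 - g₂) * s ^ 4 with hMh
  set N := 32 * x₁ + 4 * (12 * x₁ ^ 2 - g₂) * s ^ 2 - 8 * y₁ * s * R
        + (16 * x₁ ^ 3 - 4 * g₂ * x₁ + 8 * g₃) * s ^ 4 + (4 * x₁ ^ 2 - g₂) ^ 2 * s ^ 6 with hN
  have hM : 4 * (s ^ 2)⁻¹ ^ 2 + 4 * (s ^ 2)⁻¹ * x₁ + 4 * x₁ ^ 2 - g₂ = Mh / s ^ 4 := by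
    rw [hMh]; field_simp; ring
  have h2 : Mh / s ^ 4 / (D / s ^ 3) = Mh / (s * D) := by
    rw [div_div_div_eq, div_eq_div_iff (by positivity) (by positivity)]; ring
  rw [div_add' _ _ _ (pow_ne_zero 3 hs), hM, h2]
  have h3 : (Mh / (s * D)) ^ 2 / 4 - (s ^ 2)⁻¹ = (Mh ^ 2 - 4 * D ^ 2) / (4 * (s * D) ^ 2) := by
    field_simp
  rw [sub_sub ((Mh / (s * D)) ^ 2 / 4), ← sub_sub, h3, key]
  congr 1
  rw [div_eq_div_iff (by positivity) (by positivity)]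
  ring

/-- **The third-kind potential in the chart**: `s·A₁⁺/(2Du) = slp(x)/2 − √f(x)/(2x)` at `x = s⁻²`
(`√f(s⁻²) = R/s³` substituted), for `s ≠ 0`, `Du ≠ 0`. [cite: SilvermanAEC2009, III.2.3] -/
theorem cornerUp_Q_chart {g₂ g₃ x₁ y₁ s R : ℝ} (hs : s ≠ 0) (hD : R + y₁ * s ^ 3 ≠ 0)
    (hR : R ^ 2 = 4 - g₂ * s ^ 4 - g₃ * s ^ 6) :
    s * (4 * x₁ - y₁ * s * R + 4 * x₁ ^ 2 * s ^ 2 + g₃ * s ^ 4) / (2 * (R + y₁ * s ^ 3))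
      = (4 * (s ^ 2)⁻¹ ^ 2 + 4 * (s ^ 2)⁻¹ * x₁ + 4 * x₁ ^ 2 - g₂) / (R / s ^ 3 + y₁) / 2
        - R / s ^ 3 / (2 * (s ^ 2)⁻¹) := by
  have key := cornerUp_A1_poly (x₁ := x₁) (y₁ := y₁) hR
  set D := R + y₁ * s ^ 3 with hDdef
  set Mh := 4 + 4 * x₁ * s ^ 2 + (4 * x₁ ^ 2 - g₂) * s ^ 4 with hMh
  have hM : 4 * (s ^ 2)⁻¹ ^ 2 + 4 * (s ^ 2)⁻¹ * x₁ + 4 * x₁ ^ 2 - g₂ = Mh / s ^ 4 := by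
    rw [hMh]; field_simp; ring
  have h2 : Mh / s ^ 4 / (D / s ^ 3) = Mh / (s * D) := by
    rw [div_div_div_eq, div_eq_div_iff (by positivity) (by positivity)]; ring
  rw [div_add' _ _ _ (pow_ne_zero 3 hs), hM, h2]
  rw [div_eq_iff (by positivity)]
  field_simp
  linear_combination (-1) * key

/-- **The dlog potential in the chart**: `4K̂⁺W/E = Pg⁺(x)/(√f(x) + y₁)²·(s⁻¹W)/X` at `x = s⁻²`,
`X = E/(4Du²)`, `√f(s⁻²) = R/s³` (a pure identity of rational functions: `s⁵Pg⁺(s⁻²) = K̂⁺(s)`).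
[cite: SilvermanAEC2009, III.2.3] -/
theorem cornerUp_G_chart {g₂ x₁ y₁ L₁ s R E W : ℝ} (hs : s ≠ 0) (hD : R + y₁ * s ^ 3 ≠ 0)
    (hE : E ≠ 0) :
    4 * (4 * R - L₁ * s * (4 + 4 * x₁ * s ^ 2 + (4 * x₁ ^ 2 - g₂) * s ^ 4) + 8 * x₁ * s ^ 2 * R
        + 4 * y₁ * s ^ 3 + 8 * x₁ * y₁ * s ^ 5) * W / E
      = (4 * ((s ^ 2)⁻¹ + 2 * x₁) * y₁
          - L₁ * (4 * (s ^ 2)⁻¹ ^ 2 + 4 * (s ^ 2)⁻¹ * x₁ + 4 * x₁ ^ 2 - g₂)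
          + 4 * ((s ^ 2)⁻¹ + 2 * x₁) * (R / s ^ 3)) / (R / s ^ 3 + y₁) ^ 2 * (s⁻¹ * W)
          / (E / (4 * (R + y₁ * s ^ 3) ^ 2)) := by
  rw [div_add' _ _ _ (pow_ne_zero 3 hs)]
  set D := R + y₁ * s ^ 3 with hDdef
  rw [div_eq_div_iff hE (by positivity)]
  field_simp
  ring

/-! ### Values at `s₁ = x₁^{-1/2}` -/

/-- The radicand at `s₁`: `4 − g₂s₁⁴ − g₃s₁⁶ = (y₁s₁³)²` (from `s₁²x₁ = 1`, `y₁² = f(x₁)`).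
[cite: SilvermanAEC2009, III.2.3] -/
theorem cornerUp_rad_s1 : ∀ {g₂ g₃ x₁ y₁ s₁ : ℝ}, s₁ ^ 2 * x₁ = 1 → y₁ ^ 2 = 4 * x₁ ^ 3 - g₂ * x₁ - g₃ →
    4 - g₂ * s₁ ^ 4 - g₃ * s₁ ^ 6 = (-(y₁ * s₁ ^ 3)) ^ 2 := by
  intro g₂ g₃ x₁ y₁ s₁ hu hy
  linear_combination (-(4 + 4 * x₁ * s₁ ^ 2 + 4 * x₁ ^ 2 * s₁ ^ 4 - g₂ * s₁ ^ 4)) * hu - s₁ ^ 6 * hy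

/-- **`R(s₁) = −y₁s₁³`** (`y₁ < 0`, `s₁ > 0`): the chart point `s₁` is `−P₁` on the upper branch.
[cite: SilvermanAEC2009, III.2.3] -/
theorem cornerUp_R_s1 {g₂ g₃ x₁ y₁ s₁ : ℝ} (hs₁ : 0 < s₁) (hy₁ : y₁ < 0) (hu : s₁ ^ 2 * x₁ = 1)
    (hy : y₁ ^ 2 = 4 * x₁ ^ 3 - g₂ * x₁ - g₃) :
    Real.sqrt (4 - g₂ * s₁ ^ 4 - g₃ * s₁ ^ 6) = -(y₁ * s₁ ^ 3) := by
  rw [cornerUp_rad_s1 hu hy, Real.sqrt_sq]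
  have := mul_pos (neg_pos.mpr hy₁) (pow_pos hs₁ 3)
  linarith

/-- **`Ñ⁺(s₁) = s₁⁶(12x₁² − g₂)²`** (with `R(s₁) = −y₁s₁³` substituted; modulo `s₁²x₁ = 1`, `y₁² = f(x₁)`).
[cite: SilvermanAEC2009, III.2.3] -/
theorem cornerUp_Ntp_s1 {g₂ g₃ x₁ y₁ s₁ : ℝ} (hu : s₁ ^ 2 * x₁ = 1)
    (hy : y₁ ^ 2 = 4 * x₁ ^ 3 - g₂ * x₁ - g₃) :
    32 * x₁ + 4 * (12 * x₁ ^ 2 - g₂) * s₁ ^ 2 - 8 * y₁ * s₁ * (-(y₁ * s₁ ^ 3))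
        + (16 * x₁ ^ 3 - 4 * g₂ * x₁ + 8 * g₃) * s₁ ^ 4 + (4 * x₁ ^ 2 - g₂) ^ 2 * s₁ ^ 6
      = s₁ ^ 6 * (12 * x₁ ^ 2 - g₂) ^ 2 := by
  linear_combination 8 * s₁ ^ 4 * hy
    - (16 * x₁ * (8 * (x₁ * s₁ ^ 2) ^ 2 + 5 * (x₁ * s₁ ^ 2) + 2)
      - 4 * g₂ * s₁ ^ 2 * (1 + 4 * (x₁ * s₁ ^ 2))) * hu

/-- **`K̂⁺(s₁) = −L₁s₁⁵(12x₁² − g₂)`** (with `R(s₁) = −y₁s₁³` substituted; modulo `s₁²x₁ = 1`).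
[cite: SilvermanAEC2009, III.2.3] -/
theorem cornerUp_Khp_s1 {g₂ x₁ y₁ s₁ L₁ : ℝ} (hu : s₁ ^ 2 * x₁ = 1) :
    4 * (-(y₁ * s₁ ^ 3)) - L₁ * s₁ * (4 + 4 * x₁ * s₁ ^ 2 + (4 * x₁ ^ 2 - g₂) * s₁ ^ 4)
        + 8 * x₁ * s₁ ^ 2 * (-(y₁ * s₁ ^ 3)) + 4 * y₁ * s₁ ^ 3 + 8 * x₁ * y₁ * s₁ ^ 5
      = -(L₁ * s₁ ^ 5 * (12 * x₁ ^ 2 - g₂)) := by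
  linear_combination 4 * L₁ * s₁ * (1 + 2 * x₁ * s₁ ^ 2) * hu

/-! ### The regularisation at `−P₁` -/

/-- `f(E/(4D²)) = Φ/D⁶` with `Φ = E³/16 − g₂ED⁴/4 − g₃D⁶` (`D ≠ 0`). [cite: SilvermanAEC2009, III.2.3] -/
theorem cornerUp_f_X {g₂ g₃ E D : ℝ} (hD : D ≠ 0) :
    4 * (E / (4 * D ^ 2)) ^ 3 - g₂ * (E / (4 * D ^ 2)) - g₃
      = (E ^ 3 / 16 - g₂ * E * D ^ 4 / 4 - g₃ * D ^ 6) / D ^ 6 := by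
  field_simp
  ring

/-- `√f(E/(4D²)) = √Φ/D³` for `D > 0`. [cite: SilvermanAEC2009, III.2.3] -/
theorem cornerUp_sqrt_f_X {g₂ g₃ E D : ℝ} (hD : 0 < D) :
    Real.sqrt (4 * (E / (4 * D ^ 2)) ^ 3 - g₂ * (E / (4 * D ^ 2)) - g₃)
      = Real.sqrt (E ^ 3 / 16 - g₂ * E * D ^ 4 / 4 - g₃ * D ^ 6) / D ^ 3 := by
  rw [cornerUp_f_X hD.ne', Real.sqrt_div' _ (by positivity), show D ^ 6 = (D ^ 3) ^ 2 by ring,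
    Real.sqrt_sq (by positivity)]

/-- **KEY FACT of the regularisation at `−P₁`**: the numerator of `τ(E/(4D²)) + x₁` is divisible by
`D²`: `(E² + 4x₁ED² + 4cD⁴)² − 16E(r − y₁D³)² = D²·P` modulo `r² = Φ`, `y₁² = f(x₁)`
(`c = 4x₁² − g₂`; `P = 8x₁E³ + 4(12x₁² − g₂)E²D² + 32y₁EDr + 16(4x₁³ − g₂x₁ + 2g₃)ED⁴ + 16c²D⁶`).
[cite: SilvermanAEC2009, III.2.3] -/
theorem cornerUp_big {g₂ g₃ x₁ y₁ E D r : ℝ}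
    (hr : r ^ 2 = E ^ 3 / 16 - g₂ * E * D ^ 4 / 4 - g₃ * D ^ 6)
    (hy : y₁ ^ 2 = 4 * x₁ ^ 3 - g₂ * x₁ - g₃) :
    (E ^ 2 + 4 * x₁ * E * D ^ 2 + 4 * (4 * x₁ ^ 2 - g₂) * D ^ 4) ^ 2 - 16 * E * (r - y₁ * D ^ 3) ^ 2
      = D ^ 2 * (8 * x₁ * E ^ 3 + 4 * (12 * x₁ ^ 2 - g₂) * E ^ 2 * D ^ 2 + 32 * y₁ * E * D * r
        + 16 * (4 * x₁ ^ 3 - g₂ * x₁ + 2 * g₃) * E * D ^ 4 + 16 * (4 * x₁ ^ 2 - g₂) ^ 2 * D ^ 6) := by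
  linear_combination (-16 * E) * hr - 16 * E * D ^ 6 * hy

/-- **The regularised composite translation**: for `D ≠ 0`, `r − y₁D³ ≠ 0`, `r² = Φ`,
`τ(E/(4D²)) = P/(64(r − y₁D³)²) − x₁`, where `τ(X) = (M(X)/(−√f(X) + y₁))²/4 − X − x₁` is the
lower-branch translation with `√f(X) = r/D³` substituted. [cite: SilvermanAEC2009, III.2.3] -/
theorem cornerUp_T_eq {g₂ g₃ x₁ y₁ E D r : ℝ} (hD : D ≠ 0) (hB : r - y₁ * D ^ 3 ≠ 0)
    (hr : r ^ 2 = E ^ 3 / 16 - g₂ * E * D ^ 4 / 4 - g₃ * D ^ 6)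
    (hy : y₁ ^ 2 = 4 * x₁ ^ 3 - g₂ * x₁ - g₃) :
    ((4 * (E / (4 * D ^ 2)) ^ 2 + 4 * (E / (4 * D ^ 2)) * x₁ + 4 * x₁ ^ 2 - g₂)
        / (-(r / D ^ 3) + y₁)) ^ 2 / 4 - E / (4 * D ^ 2) - x₁
      = (8 * x₁ * E ^ 3 + 4 * (12 * x₁ ^ 2 - g₂) * E ^ 2 * D ^ 2 + 32 * y₁ * E * D * r
          + 16 * (4 * x₁ ^ 3 - g₂ * x₁ + 2 * g₃) * E * D ^ 4 + 16 * (4 * x₁ ^ 2 - g₂) ^ 2 * D ^ 6)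
          / (64 * (r - y₁ * D ^ 3) ^ 2) - x₁ := by
  set A := E ^ 2 + 4 * x₁ * E * D ^ 2 + 4 * (4 * x₁ ^ 2 - g₂) * D ^ 4 with hA
  set B := r - y₁ * D ^ 3 with hBdef
  have h1 : 4 * (E / (4 * D ^ 2)) ^ 2 + 4 * (E / (4 * D ^ 2)) * x₁ + 4 * x₁ ^ 2 - g₂
      = A / (4 * D ^ 4) := by
    rw [hA]; field_simp; ring
  have h2 : -(r / D ^ 3) + y₁ = -B / D ^ 3 := by
    rw [hBdef]; field_simp; ring
  rw [h1, h2]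
  have h3 : (A / (4 * D ^ 4) / (-B / D ^ 3)) ^ 2 / 4 - E / (4 * D ^ 2)
      = (A ^ 2 - 16 * E * B ^ 2) / (64 * D ^ 2 * B ^ 2) := by
    have hB' : -B ≠ 0 := neg_ne_zero.mpr hB
    field_simp
    ring
  have h4 : A ^ 2 - 16 * E * B ^ 2 = D ^ 2 * (8 * x₁ * E ^ 3 + 4 * (12 * x₁ ^ 2 - g₂) * E ^ 2 * D ^ 2
      + 32 * y₁ * E * D * r + 16 * (4 * x₁ ^ 3 - g₂ * x₁ + 2 * g₃) * E * D ^ 4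
      + 16 * (4 * x₁ ^ 2 - g₂) ^ 2 * D ^ 6) := by
    rw [hA, hBdef]; exact cornerUp_big hr hy
  rw [h3, h4]
  congr 1
  rw [div_eq_div_iff (by positivity) (by positivity)]
  ring

/-! ### `ℚ`-semialgebraicity -/

/-- Junk-tolerant quotient of real `ℚ`-semialgebraic functions (Mathlib's `x / 0 = 0` included):
`IsSemialgebraicFunOn.fun_mul` with the junk-tolerant `IsSemialgebraicFunOn.fun_inv`.
[cite: BochnakCosteRoy1998, Prop. 2.2.6] -/
theorem cornerUp_fun_div {S : Set (Fin 1 → ℝ)} {φ ψ : (Fin 1 → ℝ) → ℝ}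
    (hφ : IsSemialgebraicFunOn ℚ S φ) (hψ : IsSemialgebraicFunOn ℚ S ψ) :
    IsSemialgebraicFunOn ℚ S (fun t => φ t / ψ t) :=
  (hφ.fun_mul hψ.fun_inv).congr fun _ _ => (div_eq_mul_inv _ _).symm

/-- **All the upper-chart functions are `ℚ`-semialgebraic** on any `ℚ`-semialgebraic `S ⊆ ℝ¹`
(algebraic constants `g₂, g₃, x₁, y₁, L₁`; closure under `+, −, ×`, junk-tolerant `⁻¹`, and `√`):
`τ̂⁺`, `σ`, `Q̂⁺`, the regularised composite translation `T = P/(64(√Φ − y₁Du³)²) − x₁`, and the dlog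
potential `4K̂⁺√T/E`. [cite: BochnakCosteRoy1998, Prop. 2.2.6] -/
theorem cornerUp_semialg {g₂ g₃ x₁ y₁ L₁ : ℝ} (hg₂ : IsAlgebraic ℚ g₂) (hg₃ : IsAlgebraic ℚ g₃)
    (hx₁ : IsAlgebraic ℚ x₁) (hy₁ : IsAlgebraic ℚ y₁) (hL₁ : IsAlgebraic ℚ L₁)
    {S : Set (Fin 1 → ℝ)} (hS : IsSemialgebraic ℚ S)
    {f R Mh Du Ntp τhp E σ A₁p Qhp Khp Φf Pf T : ℝ → ℝ}
    (hf : ∀ x, f x = 4 * x ^ 3 - g₂ * x - g₃)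
    (hR : R = fun s => Real.sqrt (4 - g₂ * s ^ 4 - g₃ * s ^ 6))
    (hMh : Mh = fun s => 4 + 4 * x₁ * s ^ 2 + (4 * x₁ ^ 2 - g₂) * s ^ 4)
    (hDu : Du = fun s => R s + y₁ * s ^ 3)
    (hNtp : Ntp = fun s => 32 * x₁ + 4 * (12 * x₁ ^ 2 - g₂) * s ^ 2 - 8 * y₁ * s * R s
      + (16 * x₁ ^ 3 - 4 * g₂ * x₁ + 8 * g₃) * s ^ 4 + (4 * x₁ ^ 2 - g₂) ^ 2 * s ^ 6)
    (hτhp : τhp = fun s => Ntp s / (4 * Du s ^ 2) - x₁)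
    (hE : E = fun s => Ntp s - 4 * x₁ * Du s ^ 2)
    (hσ : σ = fun s => 2 * Du s / Real.sqrt (E s))
    (hA₁p : A₁p = fun s => 4 * x₁ - y₁ * s * R s + 4 * x₁ ^ 2 * s ^ 2 + g₃ * s ^ 4)
    (hQhp : Qhp = fun s => s * A₁p s / (2 * Du s) - Real.sqrt (f (τhp s)) / (2 * τhp s))
    (hKhp : Khp = fun s => 4 * R s - L₁ * s * Mh s + 8 * x₁ * s ^ 2 * R s + 4 * y₁ * s ^ 3
      + 8 * x₁ * y₁ * s ^ 5)
    (hΦf : Φf = fun s => E s ^ 3 / 16 - g₂ * E s * Du s ^ 4 / 4 - g₃ * Du s ^ 6)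
    (hPf : Pf = fun s => 8 * x₁ * E s ^ 3 + 4 * (12 * x₁ ^ 2 - g₂) * E s ^ 2 * Du s ^ 2
      + 32 * y₁ * E s * Du s * Real.sqrt (Φf s) + 16 * (4 * x₁ ^ 3 - g₂ * x₁ + 2 * g₃) * E s * Du s ^ 4
      + 16 * (4 * x₁ ^ 2 - g₂) ^ 2 * Du s ^ 6)
    (hT : T = fun s => Pf s / (64 * (Real.sqrt (Φf s) - y₁ * Du s ^ 3) ^ 2) - x₁) :
    IsSemialgebraicFunOn ℚ S (fun t => τhp (t 0)) ∧ IsSemialgebraicFunOn ℚ S (fun t => σ (t 0)) ∧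
    IsSemialgebraicFunOn ℚ S (fun t => Qhp (t 0)) ∧ IsSemialgebraicFunOn ℚ S (fun t => T (t 0)) ∧
    IsSemialgebraicFunOn ℚ S (fun t => 4 * Khp (t 0) * Real.sqrt (T (t 0)) / E (t 0)) := by
  have hX : IsSemialgebraicFunOn ℚ S (fun t => t 0) :=
    (isSemialgebraicFunOn_aeval hS (X 0)).congr fun x _ => by simp
  have c {a : ℝ} (ha : IsAlgebraic ℚ a) : IsSemialgebraicFunOn ℚ S (fun _ => a) :=
    isSemialgebraicFunOn_const_of_isAlgebraic hS ha
  have n (k : ℕ) [k.AtLeastTwo] : IsSemialgebraicFunOn ℚ S (fun _ => (OfNat.ofNat k : ℝ)) :=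
    isSemialgebraicFunOn_const_ofNat hS k
  -- `R`, `M̂`, `Du`, `Ñ⁺`
  have sR : IsSemialgebraicFunOn ℚ S (fun t => R (t 0)) :=
    (((n 4).fun_sub ((c hg₂).fun_mul (hX.fun_pow 4))).fun_sub
      ((c hg₃).fun_mul (hX.fun_pow 6))).fun_sqrt.congr fun t _ => by rw [hR]
  have sMh : IsSemialgebraicFunOn ℚ S (fun t => Mh (t 0)) :=
    (((n 4).fun_add (((n 4).fun_mul (c hx₁)).fun_mul (hX.fun_pow 2))).fun_add
      ((((n 4).fun_mul ((c hx₁).fun_pow 2)).fun_sub (c hg₂)).fun_mul (hX.fun_pow 4))).congr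
      fun t _ => by rw [hMh]
  have sDu : IsSemialgebraicFunOn ℚ S (fun t => Du (t 0)) :=
    (sR.fun_add ((c hy₁).fun_mul (hX.fun_pow 3))).congr fun t _ => by rw [hDu]
  have sNtp : IsSemialgebraicFunOn ℚ S (fun t => Ntp (t 0)) :=
    ((((((n 32).fun_mul (c hx₁)).fun_add
      (((n 4).fun_mul (((n 12).fun_mul ((c hx₁).fun_pow 2)).fun_sub (c hg₂))).fun_mul
        (hX.fun_pow 2))).fun_sub
      ((((n 8).fun_mul (c hy₁)).fun_mul hX).fun_mul sR)).fun_add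
      (((((n 16).fun_mul ((c hx₁).fun_pow 3)).fun_sub (((n 4).fun_mul (c hg₂)).fun_mul
        (c hx₁))).fun_add ((n 8).fun_mul (c hg₃))).fun_mul (hX.fun_pow 4))).fun_add
      (((((n 4).fun_mul ((c hx₁).fun_pow 2)).fun_sub (c hg₂)).fun_pow 2).fun_mul
        (hX.fun_pow 6))).congr fun t _ => by rw [hNtp]
  -- `τ̂⁺`, `E`, `σ`, `A₁⁺`, `f ∘ τ̂⁺`, `Q̂⁺`, `K̂⁺`
  have sτ : IsSemialgebraicFunOn ℚ S (fun t => τhp (t 0)) :=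
    ((cornerUp_fun_div sNtp ((n 4).fun_mul (sDu.fun_pow 2))).fun_sub (c hx₁)).congr
      fun t _ => by rw [hτhp]
  have sE : IsSemialgebraicFunOn ℚ S (fun t => E (t 0)) :=
    (sNtp.fun_sub (((n 4).fun_mul (c hx₁)).fun_mul (sDu.fun_pow 2))).congr fun t _ => by rw [hE]
  have sσ : IsSemialgebraicFunOn ℚ S (fun t => σ (t 0)) :=
    (cornerUp_fun_div ((n 2).fun_mul sDu) sE.fun_sqrt).congr fun t _ => by rw [hσ]
  have sA : IsSemialgebraicFunOn ℚ S (fun t => A₁p (t 0)) :=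
    (((((n 4).fun_mul (c hx₁)).fun_sub (((c hy₁).fun_mul hX).fun_mul sR)).fun_add
      (((n 4).fun_mul ((c hx₁).fun_pow 2)).fun_mul (hX.fun_pow 2))).fun_add
      ((c hg₃).fun_mul (hX.fun_pow 4))).congr fun t _ => by rw [hA₁p]
  have sfτ : IsSemialgebraicFunOn ℚ S (fun t => f (τhp (t 0))) :=
    ((((n 4).fun_mul (sτ.fun_pow 3)).fun_sub ((c hg₂).fun_mul sτ)).fun_sub (c hg₃)).congr
      fun t _ => by rw [hf]
  have sQ : IsSemialgebraicFunOn ℚ S (fun t => Qhp (t 0)) :=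
    ((cornerUp_fun_div (hX.fun_mul sA) ((n 2).fun_mul sDu)).fun_sub
      (cornerUp_fun_div sfτ.fun_sqrt ((n 2).fun_mul sτ))).congr fun t _ => by rw [hQhp]
  have sK : IsSemialgebraicFunOn ℚ S (fun t => Khp (t 0)) :=
    ((((((n 4).fun_mul sR).fun_sub (((c hL₁).fun_mul hX).fun_mul sMh)).fun_add
      ((((n 8).fun_mul (c hx₁)).fun_mul (hX.fun_pow 2)).fun_mul sR)).fun_add
      (((n 4).fun_mul (c hy₁)).fun_mul (hX.fun_pow 3))).fun_add
      ((((n 8).fun_mul (c hx₁)).fun_mul (c hy₁)).fun_mul (hX.fun_pow 5))).congr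
      fun t _ => by rw [hKhp]
  -- `Φ`, `P`, `T`, `4K̂⁺√T/E`
  have sΦ : IsSemialgebraicFunOn ℚ S (fun t => Φf (t 0)) :=
    (((cornerUp_fun_div (sE.fun_pow 3) (n 16)).fun_sub
      (cornerUp_fun_div (((c hg₂).fun_mul sE).fun_mul (sDu.fun_pow 4)) (n 4))).fun_sub
      ((c hg₃).fun_mul (sDu.fun_pow 6))).congr fun t _ => by rw [hΦf]
  have cC : IsSemialgebraicFunOn ℚ S (fun _ => 4 * x₁ ^ 2 - g₂) :=
    ((n 4).fun_mul ((c hx₁).fun_pow 2)).fun_sub (c hg₂)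
  have p1 : IsSemialgebraicFunOn ℚ S (fun t => 8 * x₁ * E (t 0) ^ 3) :=
    ((n 8).fun_mul (c hx₁)).fun_mul (sE.fun_pow 3)
  have p2 : IsSemialgebraicFunOn ℚ S
      (fun t => 4 * (12 * x₁ ^ 2 - g₂) * E (t 0) ^ 2 * Du (t 0) ^ 2) :=
    (((n 4).fun_mul (((n 12).fun_mul ((c hx₁).fun_pow 2)).fun_sub (c hg₂))).fun_mul
      (sE.fun_pow 2)).fun_mul (sDu.fun_pow 2)
  have p3 : IsSemialgebraicFunOn ℚ S
      (fun t => 32 * y₁ * E (t 0) * Du (t 0) * Real.sqrt (Φf (t 0))) :=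
    ((((n 32).fun_mul (c hy₁)).fun_mul sE).fun_mul sDu).fun_mul sΦ.fun_sqrt
  have p4 : IsSemialgebraicFunOn ℚ S
      (fun t => 16 * (4 * x₁ ^ 3 - g₂ * x₁ + 2 * g₃) * E (t 0) * Du (t 0) ^ 4) :=
    (((n 16).fun_mul ((((n 4).fun_mul ((c hx₁).fun_pow 3)).fun_sub ((c hg₂).fun_mul
      (c hx₁))).fun_add ((n 2).fun_mul (c hg₃)))).fun_mul sE).fun_mul (sDu.fun_pow 4)
  have p5 : IsSemialgebraicFunOn ℚ S (fun t => 16 * (4 * x₁ ^ 2 - g₂) ^ 2 * Du (t 0) ^ 6) :=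
    ((n 16).fun_mul (cC.fun_pow 2)).fun_mul (sDu.fun_pow 6)
  have sP : IsSemialgebraicFunOn ℚ S (fun t => Pf (t 0)) :=
    ((((p1.fun_add p2).fun_add p3).fun_add p4).fun_add p5).congr fun t _ => by rw [hPf]
  have sT : IsSemialgebraicFunOn ℚ S (fun t => T (t 0)) :=
    ((cornerUp_fun_div sP ((n 64).fun_mul ((sΦ.fun_sqrt.fun_sub ((c hy₁).fun_mul
      (sDu.fun_pow 3))).fun_pow 2))).fun_sub (c hx₁)).congr fun t _ => by rw [hT]
  exact ⟨sτ, sσ, sQ, sT, cornerUp_fun_div (((n 4).fun_mul sK).fun_mul sT.fun_sqrt) sE⟩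

end Summit.KontsevichZagierPeriods.KontsevichZagierPeriods.Cruxes.NeronTorsionSector.Translation
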